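import Mathlib
import Summits.HubbardSuperconductivity.HubbardSuperconductivity.Theorems.BalabanIRBirGappedPhaseReductionRBlockLondonStripPointwise

/-!
# Route BalabanIR — crux 4R `BirGappedPhaseReductionR` (item `stmt-HubbardSuperconductivity-14846`):
# block-London coercivity VII — every momentum column near a Fermi point meets the strip in an
# interval of length `≍ D`

For the hopping symbol `ξ(k) = -2cos k₀ - 2cos k₁ - μ` near a Fermi point `b` (`ξ(b) = 0`,
`sin b₀ = S > 0`), in each column `k₁ = p₁` with `|p₁ - b₁| ≤ ρS/4` the function
`x ↦ ξ(x, p₁)` increases at rate `≥ S` across `[b₀ - ρ, b₀ + ρ]` (`16ρ ≤ S`), runs from `≤ -ρS/2`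
to `≥ ρS/2`, hence (intermediate value theorem) takes the window `[0.55 D, 1.8 D]` on an interval
`[α, β]` of length `≥ 0.625 D` as soon as `1.8 D ≤ ρS/2`; on that interval the strip condition
`1/2 ≤ ξ/|Δ| ≤ 2` of `strip_pointwise` holds because `|Δ| ∈ [0.95 D, 1.05 D]` on the box
(`strip_amplitude`).  THEOREM `strip_column`.  No definition is introduced.
-/

noncomputable section

namespace Summit.HubbardSuperconductivity.HubbardSuperconductivity.Theorems

namespace BirBdG

/-- Monotonicity of the column profile: for `x ≤ x'` in `[b₀-ρ, b₀+ρ]` with `sin ≥ S - ρ ≥ 0`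
on that interval… stated through the chord identity:
`ξ(x',p₁) - ξ(x,p₁) = 4 sin((x+x')/2) sin((x'-x)/2)`. [folklore] -/
theorem xi_column_sub (μ p₁ x x' : ℝ) :
    (-2 * Real.cos x' - 2 * Real.cos p₁ - μ) - (-2 * Real.cos x - 2 * Real.cos p₁ - μ) =
      4 * Real.sin ((x + x') / 2) * Real.sin ((x' - x) / 2) := by
  have h := Real.cos_sub_cos x x'
  have e : (x - x') / 2 = -((x' - x) / 2) := by ring
  rw [e, Real.sin_neg] at h
  linarith

/-- Lower Lipschitz bound of the column profile: if `sin y ≥ S/2` for all `y ∈ [b₀-ρ, b₀+ρ]`, then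
for `b₀ - ρ ≤ x ≤ x' ≤ b₀ + ρ` (`ρ ≤ 1`, `S ≥ 0`), `ξ(x') - ξ(x) ≥ (S/2)(x' - x)`. [folklore] -/
theorem xi_column_mono (μ p₁ S b₀ ρ : ℝ) (hS0 : 0 ≤ S) (hρ1 : ρ ≤ 1)
    (hsin : ∀ y, b₀ - ρ ≤ y → y ≤ b₀ + ρ → S / 2 ≤ Real.sin y)
    {x x' : ℝ} (hx : b₀ - ρ ≤ x) (hxx' : x ≤ x') (hx' : x' ≤ b₀ + ρ) :
    S / 2 * (x' - x) ≤ (-2 * Real.cos x' - 2 * Real.cos p₁ - μ) - (-2 * Real.cos x - 2 * Real.cos p₁ - μ) := by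
  rw [xi_column_sub]
  have hmid : S / 2 ≤ Real.sin ((x + x') / 2) := hsin _ (by linarith) (by linarith)
  have hd0 : 0 ≤ (x' - x) / 2 := by linarith
  have hd1 : (x' - x) / 2 ≤ 1 := by linarith
  -- Jordan on `[0, 1] ⊂ [0, π/2]`: `sin d ≥ (2/π) d ≥ d/2`
  have hj : (x' - x) / 2 / 2 ≤ Real.sin ((x' - x) / 2) := by
    have h1 := Real.mul_le_sin hd0 (by linarith [Real.pi_gt_three])
    have h2 : (x' - x) / 2 / 2 ≤ 2 / Real.pi * ((x' - x) / 2) := by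
      have hπ : (1 : ℝ) / 2 ≤ 2 / Real.pi := by
        rw [div_le_div_iff₀ (by norm_num) Real.pi_pos]; linarith [Real.pi_lt_four]
      have := mul_le_mul_of_nonneg_right hπ hd0
      linarith
    linarith
  calc S / 2 * (x' - x) = 4 * (S / 2) * ((x' - x) / 2 / 2) := by ring
    _ ≤ 4 * Real.sin ((x + x') / 2) * Real.sin ((x' - x) / 2) := by
        have := mul_le_mul hmid hj (by linarith) (by linarith : (0 : ℝ) ≤ Real.sin ((x + x') / 2))
        linarith

/-- Upper Lipschitz bound of the column profile: `|ξ(x') - ξ(x)| ≤ 2|x' - x|`. [folklore] -/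
theorem xi_column_lip (μ p₁ x x' : ℝ) :
    |(-2 * Real.cos x' - 2 * Real.cos p₁ - μ) - (-2 * Real.cos x - 2 * Real.cos p₁ - μ)| ≤ 2 * |x' - x| := by
  rw [xi_column_sub, abs_mul, abs_mul, show |(4 : ℝ)| = 4 by norm_num]
  have h1 := Real.abs_sin_le_one ((x + x') / 2)
  have h2 : |Real.sin ((x' - x) / 2)| ≤ |x' - x| / 2 := by
    have := Real.abs_sin_le_abs (x := (x' - x) / 2)
    rwa [abs_div, abs_two] at this
  calc 4 * |Real.sin ((x + x') / 2)| * |Real.sin ((x' - x) / 2)| ≤ 4 * 1 * (|x' - x| / 2) := by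
        gcongr
    _ = 2 * |x' - x| := by ring

/-- **Every momentum column near a Fermi point meets the strip in an interval of length `≥ 5D/8`.**
See the module docstring. [folklore] -/
theorem strip_column : ∀ (μ Δ₁ Δ₂ S D ρ p₁ : ℝ) (b : Fin 2 → ℝ) (ξc : (Fin 2 → ℝ) → ℝ), (∀ p, ξc p = -2 * Real.cos (p 0) - 2 * Real.cos (p 1) - μ) → ∀ (Δc : (Fin 2 → ℝ) → ℂ), (∀ p, Δc p = ((2 * Δ₁ * (Real.cos (p 0) - Real.cos (p 1)) : ℝ) : ℂ) - 4 * Complex.I * ((Δ₂ * Real.sin (p 0) * Real.sin (p 1) : ℝ) : ℂ)) → 0 < S → 0 < ρ → 16 * ρ ≤ S → ξc b = 0 → Real.sin (b 0) = S → ‖Δc b‖ = D → 0 < D → (2 * |Δ₁| + 4 * |Δ₂|) * (4 * ρ) ≤ D / 10 → 18 / 10 * D ≤ ρ * S / 4 → |p₁ - b 1| ≤ ρ * S / 8 → ∃ α β : ℝ, b 0 - ρ ≤ α ∧ α ≤ β ∧ β ≤ b 0 + ρ ∧ 5 / 8 * D ≤ β - α ∧ ∀ x, α ≤ x → x ≤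 β → (∀ i, |(![x, p₁] : Fin 2 → ℝ) i - b i| ≤ ρ) ∧ (1 / 2 ≤ ξc ![x, p₁] / ‖Δc ![x, p₁]‖ ∧ ξc ![x, p₁] / ‖Δc ![x, p₁]‖ ≤ 2) := by
  intro μ Δ₁ Δ₂ S D ρ p₁ b ξc hξc Δc hΔc hSpos hρ h16ρ hb hsinb hD hDpos hρD hDρ hp₁
  have hS1 : S ≤ 1 := hsinb ▸ Real.sin_le_one _
  have hρ1 : ρ ≤ 1 := by linarith
  -- the column profile
  set g : ℝ → ℝ := fun x => -2 * Real.cos x - 2 * Real.cos p₁ - μ with hg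
  have hgx : ∀ x, ξc ![x, p₁] = g x := fun x => by
    rw [hξc]; simp [hg]
  have hgcont : Continuous g := by rw [hg]; fun_prop
  -- `sin ≥ S/2` on the column range
  have hsin : ∀ y, b 0 - ρ ≤ y → y ≤ b 0 + ρ → S / 2 ≤ Real.sin y := by
    intro y h1 h2
    have := Real.abs_sin_sub_sin_le y (b 0)
    rw [hsinb] at this
    have hy : |y - b 0| ≤ ρ := abs_le.2 ⟨by linarith, by linarith⟩
    have := (abs_le.1 (this.trans hy)).1
    linarith
  have hmono : ∀ {x x' : ℝ}, b 0 - ρ ≤ x → x ≤ x' → x' ≤ b 0 + ρ → S / 2 * (x' - x) ≤ g x' - g x :=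
    fun hx hxx' hx' => xi_column_mono μ p₁ S (b 0) ρ hSpos.le hρ1 hsin hx hxx' hx'
  -- the value at the centre of the column
  have hg0 : |g (b 0)| ≤ ρ * S / 4 := by
    have e : g (b 0) = ξc b + (2 * Real.cos (b 1) - 2 * Real.cos p₁) := by
      rw [hξc]; simp [hg]; ring
    rw [e, hb, zero_add]
    calc |2 * Real.cos (b 1) - 2 * Real.cos p₁| = 2 * |Real.cos (b 1) - Real.cos p₁| := by
          rw [← mul_sub, abs_mul, abs_two]
      _ ≤ 2 * |b 1 - p₁| := by linarith [Real.abs_cos_sub_cos_le (b 1) p₁]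
      _ = 2 * |p₁ - b 1| := by rw [abs_sub_comm]
      _ ≤ 2 * (ρ * S / 8) := by gcongr
      _ = ρ * S / 4 := by ring
  have hgtop : 18 / 10 * D ≤ g (b 0 + ρ) := by
    have := hmono (x := b 0) (x' := b 0 + ρ) (by linarith) (by linarith) le_rfl
    have h0 := (abs_le.1 hg0).1
    nlinarith
  have hgbot : g (b 0 - ρ) ≤ 55 / 100 * D := by
    have := hmono (x := b 0 - ρ) (x' := b 0) le_rfl (by linarith) (by linarith)
    have h0 := (abs_le.1 hg0).2
    nlinarith
  -- intermediate values
  have hIVT := intermediate_value_Icc (show b 0 - ρ ≤ b 0 + ρ by linarith) hgcont.continuousOn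
  have hlo : (55 / 100 * D) ∈ Set.Icc (g (b 0 - ρ)) (g (b 0 + ρ)) := ⟨hgbot, by linarith⟩
  have hhi : (18 / 10 * D) ∈ Set.Icc (g (b 0 - ρ)) (g (b 0 + ρ)) := ⟨by linarith, hgtop⟩
  obtain ⟨α, ⟨hα1, hα2⟩, hgα⟩ := hIVT hlo
  obtain ⟨β, ⟨hβ1, hβ2⟩, hgβ⟩ := hIVT hhi
  have hαβ : α ≤ β := by
    by_contra h
    push Not at h
    have := hmono hβ1 h.le hα2
    rw [hgα, hgβ] at this
    nlinarith
  have hlen : 5 / 8 * D ≤ β - α := by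
    have := xi_column_lip μ p₁ α β
    change |g β - g α| ≤ 2 * |β - α| at this
    rw [hgα, hgβ, abs_of_nonneg (sub_nonneg.2 hαβ)] at this
    rw [abs_of_nonneg (by linarith : (0 : ℝ) ≤ 18 / 10 * D - 55 / 100 * D)] at this
    linarith
  refine ⟨α, β, hα1, hαβ, hβ2, hlen, fun x hxα hxβ => ?_⟩
  -- the point `(x, p₁)` is in the box
  have hbox : ∀ i, |(![x, p₁] : Fin 2 → ℝ) i - b i| ≤ ρ := by
    intro i
    fin_cases i
    · simp only [Fin.zero_eta, Fin.isValue, Matrix.cons_val_zero]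
      exact abs_le.2 ⟨by linarith, by linarith⟩
    · simp only [Fin.mk_one, Fin.isValue, Matrix.cons_val_one, Matrix.cons_val_fin_one]
      calc |p₁ - b 1| ≤ ρ * S / 8 := hp₁
        _ ≤ ρ := by nlinarith
  refine ⟨hbox, ?_⟩
  -- amplitude within `5%` and the window
  obtain ⟨⟨ha1l, ha1u⟩, -, -⟩ := strip_amplitude Δ₁ Δ₂ D ρ b ![x, p₁] 0 Δc hΔc hD hρD hbox
    (fun i => by simp [hρ.le])
  have hgxlo : 55 / 100 * D ≤ g x := by
    have := hmono hα1 hxα (hxβ.trans hβ2); rw [hgα] at this; nlinarith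
  have hgxhi : g x ≤ 18 / 10 * D := by
    have := hmono (hα1.trans hxα) hxβ hβ2; rw [hgβ] at this; nlinarith
  have hapos : 0 < ‖Δc ![x, p₁]‖ := by linarith
  rw [hgx]
  constructor
  · rw [le_div_iff₀ hapos]; linarith
  · rw [div_le_iff₀ hapos]; linarith

end BirBdG

end Summit.HubbardSuperconductivity.HubbardSuperconductivity.Theorems

end
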